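import Summits.QuantumFields.YangMills.Theorems.SandwichVariancePinchingCeilingMollification
import Summits.QuantumFields.YangMills.Theorems.SandwichVariancePinchingCeilingWhitening

/-!
# Route `SandwichVariancePinching` — crux `QuadraticVarianceCeiling` (stmt-QuantumFields-28259) PROVED

`gE(q²) − gE(q)² ≤ (1 + 26δ)·(2 tr(H₀⁻¹HH₀⁻¹H) + bᵀH₀⁻¹b)` for every `n`, `H₀ ≻ 0`, symmetric `H`, `b ∈ ℝⁿ`,
every CONTINUOUS potential `A` with the second-difference sandwich `(1−δ)hᵀH₀h ≤ A(x+h)+A(x−h)−2A(x) ≤ (1+δ)hᵀH₀h`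
and the centring `∫ x_i e^{−A} = 0`, for all `0 ≤ δ ≤ 1/2` — the crux BY NAME with `C = 26`, `δ₀ = 1/2`,
constants independent of the dimension.  Route: Stein proxy — with `u = Hx + b` the affine score is
`q − trH + R₀`; `Var G` by the score identity (I2) and first-order Brascamp–Lieb on the rows of `H`; `Var R₀`
by first-order Brascamp–Lieb on the `O(δ)` remainder (defect bound `‖D²A − 1‖ ≤ δ`).  No Helffer–Sjöstrand and no
optimal transport (so `LogConcaveChart.QuadraticCovarianceComparison` no longer depends on the named fact
`Caffarelli2000_sandwichBrenierMap`).

HONEST SCOPE.  Free-hands work of the LEAD seat of crux stmt-QuantumFields-22884 (cell ym-idea-1).  Closes the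
deciding crux of planner ym-idea-3's draft-by-design sub-line; `LogConcaveChart`'s other cruxes (UnitScaleChart,
SkewAtChartUnit), rung R2a (`BalabanLadder.NT`) and every summit statement remain OPEN; the Yang–Mills mass gap is
NOT proved by any of this.
-/

noncomputable section

namespace Summit.QuantumFields.YangMills.Theorems

open SandwichVariancePinching in
/-- **Crux `QuadraticVarianceCeiling` (stmt-QuantumFields-28259)**, with `C = 26` and `δ₀ = 1/2`. [folklore] -/
theorem sandwichVariancePinching_quadraticVarianceCeiling_proof :
    Summit.QuantumFields.YangMills.Theses.SandwichVariancePinching.QuadraticVarianceCeiling :=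
  quadraticVarianceCeiling_of_whitened ⟨26, 1 / 2, by norm_num, by norm_num, by norm_num,
    fun δ hδ hδ2 n H b A hH hA hsw hcent => ceilingWhitened (n := n) hδ hδ2 H b hH hA hsw hcent⟩

end Summit.QuantumFields.YangMills.Theorems

end
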